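import Mathlib.RepresentationTheory.Maschke
import Mathlib.RingTheory.SimpleModule.Basic
import Mathlib.RingTheory.Ideal.Maps
import Mathlib.Algebra.Field.ZMod
import Literature.InformationTheory.QuantumCodes.TwoBlockCodeDimension
import HarnessLib

/-!
# Products in minimal vs. maximal ideals of a semisimple group algebra
# (Lin–Pryadko 2024 §IV.F: the sentence behind Statement 13 — corrected form proved, printed form refuted)

Lin–Pryadko [LinPryadko2024, §IV.F] (held text arXiv:2306.16400) prepare the distance UPPER bound
Statement 13 (= a version of Kovalev–Pryadko 2013 Thm 6) for quasi-abelian 2BGA codes with abelian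
intersection subgroup `N`: "Let `J` be a maximal ideal in `F[N]` …" (chunk p0011 L119) and state (chunk p0011
L133–135): "The proof of the following upper bound is based on the fact that the product of any two
non-zero elements in a maximum ideal is non-zero." The proof (§VIII.F, chunk p0020 L86–88) uses it as
"`y_α ∈ J`, a maximal ideal, which ensures that `uy = Σ_α Σ_β α u_α y_β β ≠ 0`".

The qec programme recorded this sentence as a PROOF GAP (finding E-8): it is false for maximal ideals. The
mechanism of Statement 13 with the non-vanishing `uy ≠ 0` taken as an explicit hypothesis is proved in
`QuasiAbelianLPDistanceUpper.lean`. This file puts both halves of E-8 into the tree, with NO named facts: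

* `mul_ne_zero_of_mem_isAtom` — **the corrected sentence, PROVED**: in a commutative semisimple ring the
  product of two non-zero elements of a MINIMAL (non-zero) ideal is non-zero (a minimal ideal `Re`, `e² = e`,
  is a simple component — a field with unit `e`); `groupAlgebra_mul_ne_zero_of_mem_isAtom` — the same in
  LP24's setting `F[N]`, `N` finite abelian, `char F ∤ |N|` (Maschke, Mathlib's
  `IsSemisimpleRing (AddMonoidAlgebra F N)`). This is the hypothesis the source [KovalevPryadko2013Hyperbicycle,
  Thm 6] actually uses (an irreducible factor `p(x)` of `x^c − 1`, i.e. the minimal ideal / field component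
  `𝔽₂[x]/p(x)`).
* `maximal_counterexample` — **the printed sentence, REFUTED in a semisimple group algebra**: in `𝔽₂[ℤ₇]`
  (`f2z7_isSemisimpleRing`) the augmentation ideal `J = ker(x ↦ 1)` is maximal and contains
  `u = (1+x)(1+x+x³) ≠ 0`, `y = (1+x)(1+x²+x³) ≠ 0` with `uy = (1+x)²(1+x+⋯+x⁶) = (1+x)(x⁷−1) = 0`
  (kernel-checked: `ring` + `x⁷ = 1` + `2 = 0`, non-vanishing by the coefficient at `0`).

* (appended) `f2z2_span_isAtom`, `f2z2_span_isSemisimpleModule`, `f2z2_span_not_idempotent_generated`,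
  `statement10_moduleReading_counterexample` — in `𝔽₂[ℤ₂]` the ideal `(1+x)R = {0, 1+x}` is a SIMPLE (so semisimple)
  module but not a direct summand, and `LP[1+x,1+x]` has `δ_X = δ_Z = 1` (`TwoBlock.fourTwoTwo_defects`): the
  hypothesis of LP24 Statement 10 read as "semisimple `R`-modules" does not give `δ_X = δ_Z = 0` (its direct-summand
  form is proved in `TwoBlockGASemisimpleDefects.lean`).

No failure of Statement 13's BOUND is claimed or exhibited — only of the printed justification; with "maximal"
read as "minimal" the printed proof goes through (the terms `α(u_α y_β)β` occupy distinct double-coset slots,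
so `uy ≠ 0` iff some `u_α y_β ≠ 0`, which `mul_ne_zero_of_mem_isAtom` supplies).

## References (locators read on the page)

* [LinPryadko2024] H.-K. Lin, L. P. Pryadko, *Quantum two-block group algebra codes*, PRA 109 (2024) 022407 =
  arXiv:2306.16400: §II.A (chunk p0004 L97–105, Maschke / idempotent generators, citing Drozd–Kirichenko Cor. 2.2.5);
  §IV.F (chunk p0011 L119–135), Statement 13 (chunk p0012 L1–10), proof §VIII.F (chunk p0020 L58–92).
* [KovalevPryadko2013Hyperbicycle] A. A. Kovalev, L. P. Pryadko, PRA 88 (2013) 012311 = arXiv:1212.6703, Thm 6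
  (chunk p0012 L5–20: the symmetry class of an irreducible factor `p(x)`).
-/

namespace Literature.InformationTheory.QuantumCodes

namespace GroupAlgebraIdeal

/-! ### The corrected sentence: a MINIMAL ideal of a commutative semisimple ring has no zero-divisor pairs -/

/-- **In a commutative semisimple ring, the product of two non-zero elements of a MINIMAL (non-zero) ideal is
non-zero** — a minimal ideal `J = Re` (`e² = e`) is a simple component, a field with unit `e`: from `u ≠ 0`,
`Ru = J ∋ e`, so `e = ru`, and `y = ye`; `uy = 0` would give `y = y(ru) = r(uy) = 0`.
This is the corrected form of the printed "the product of any two non-zero elements in a maximum ideal is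
non-zero" (false for maximal ideals, `maximal_counterexample` below).
[cite: LinPryadko2024, §IV.F sentence before Statement 13 (arXiv:2306.16400 chunk p0011 L133–135) with §II.A "any ideal is a principal ideal generated by an idempotent" (chunk p0004 L97–105)] -/
theorem mul_ne_zero_of_mem_isAtom {R : Type*} [CommRing R] [IsSemisimpleRing R] {J : Ideal R} (hJ : IsAtom J)
    {u y : R} (hu : u ∈ J) (hy : y ∈ J) (hu0 : u ≠ 0) (hy0 : y ≠ 0) : u * y ≠ 0 := by
  obtain ⟨e, he, hJe⟩ := IsSemisimpleRing.ideal_eq_span_idempotent J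
  have hle : Ideal.span {u} ≤ J := by
    rw [Ideal.span_le, Set.singleton_subset_iff]
    exact hu
  have hspan : Ideal.span {u} = J :=
    (hJ.le_iff.mp hle).resolve_left fun h => hu0 (Ideal.span_singleton_eq_bot.mp h)
  have he' : e ∈ Ideal.span {u} := by
    rw [hspan, hJe]
    exact Ideal.mem_span_singleton_self e
  obtain ⟨r, hr⟩ := Ideal.mem_span_singleton'.mp he'
  have hy' : y ∈ Ideal.span {e} := hJe ▸ hy
  obtain ⟨s, hs⟩ := Ideal.mem_span_singleton'.mp hy'
  intro h0
  have hye : y = y * e := by rw [← hs, mul_assoc, he.eq]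
  apply hy0
  rw [hye, ← hr, ← mul_assoc, mul_comm y r, mul_assoc, mul_comm y u, h0, mul_zero]

/-- The same for the commutative group algebra `F[N]` of a finite abelian group with `char F ∤ |N|`
(semisimple by Maschke), the setting of LP24 §IV.F (`N = G_a ∩ G_b` abelian).
[cite: LinPryadko2024, §IV.F (arXiv:2306.16400 chunk p0011 L119–135) with §II.A (chunk p0004 L97–105)] -/
theorem groupAlgebra_mul_ne_zero_of_mem_isAtom {F : Type*} [Field F] {N : Type*} [AddCommGroup N] [Finite N]
    [NeZero (Nat.card N : F)] {J : Ideal (AddMonoidAlgebra F N)} (hJ : IsAtom J)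
    {u y : AddMonoidAlgebra F N} (hu : u ∈ J) (hy : y ∈ J) (hu0 : u ≠ 0) (hy0 : y ≠ 0) : u * y ≠ 0 :=
  mul_ne_zero_of_mem_isAtom hJ hu hy hu0 hy0

/-! ### The printed sentence fails: a maximal ideal of the semisimple `𝔽₂[ℤ₇]` with a zero-divisor pair -/

section Counterexample

open AddMonoidAlgebra

/-- `𝔽₂[ℤ₇]` (as Mathlib's `AddMonoidAlgebra (ZMod 2) (ZMod 7)`). (definition, auxiliary) [folklore] -/
private abbrev R27 : Type := AddMonoidAlgebra (ZMod 2) (ZMod 7)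

/-- The generator `x` of `ℤ₇` in `𝔽₂[ℤ₇]`. [folklore] -/
private noncomputable def X7 : R27 := single 1 1

/-- `x⁷ = 1` in `𝔽₂[ℤ₇]`. [folklore] -/
private theorem X7_pow_seven : X7 ^ 7 = 1 := by
  rw [X7, single_pow, one_def]
  congr 1

/-- `2 = 0` in `𝔽₂[ℤ₇]`. [folklore] -/
private theorem two_eq_zero_R27 : (2 : R27) = 0 := by
  have h : (2 : R27) = algebraMap (ZMod 2) R27 2 := (map_ofNat (algebraMap (ZMod 2) R27) 2).symm
  rw [h, show (2 : ZMod 2) = 0 from rfl, map_zero]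

/-- The augmentation `ε : 𝔽₂[ℤ₇] → 𝔽₂`, `x ↦ 1`. [folklore] -/
private noncomputable def aug : R27 →+* ZMod 2 :=
  liftNCRingHom (RingHom.id (ZMod 2)) 1 fun _ _ => Commute.all _ _

/-- [folklore] -/
private theorem aug_X7 : aug X7 = 1 := by
  rw [aug, X7, liftNCRingHom_single]
  simp

/-- [folklore] -/
private theorem aug_surjective : Function.Surjective aug := by
  intro c
  refine ⟨single 0 c, ?_⟩
  rw [aug, liftNCRingHom_single]
  simp

/-- `𝔽₂[ℤ₇]` is semisimple (`7` is odd — Maschke). [cite: LinPryadko2024, §II.A "if characteristic of the field does not divide the group size … the group algebra is semisimple" (arXiv:2306.16400 chunk p0004 L97–100)] -/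
theorem f2z7_isSemisimpleRing : IsSemisimpleRing (AddMonoidAlgebra (ZMod 2) (ZMod 7)) := by
  haveI : NeZero (Nat.card (ZMod 7) : ZMod 2) := ⟨by rw [Nat.card_zmod]; decide⟩
  infer_instance

/-- `u = (1+x)(1+x+x³)`, `y = (1+x)(1+x²+x³)` in `𝔽₂[ℤ₇]`. [folklore] -/
private noncomputable def u7 : R27 := (1 + X7) * (1 + X7 + X7 ^ 3)

/-- [folklore] -/
private noncomputable def y7 : R27 := (1 + X7) * (1 + X7 ^ 2 + X7 ^ 3)

/-- `u y = (1+x)² · (x⁷−1)/(x−1) = (1+x)(x⁷+1) + 2(…) = 0`. [folklore] -/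
private theorem u7_mul_y7 : u7 * y7 = 0 := by
  have hring : u7 * y7 = (1 + X7) * (1 + X7 ^ 7) +
      2 * ((1 + X7) * (X7 + X7 ^ 2 + 2 * X7 ^ 3 + 2 * X7 ^ 4 + X7 ^ 5 + X7 ^ 6) ) := by
    rw [u7, y7]; ring
  rw [hring, X7_pow_seven, one_add_one_eq_two, two_eq_zero_R27, mul_zero, zero_mul, add_zero]

/-- `u = 1 + x² + x³ + x⁴ ≠ 0` (its coefficient at `0` is `1`). [folklore] -/
private theorem u7_ne_zero : u7 ≠ 0 := by
  have hring : u7 = 1 + X7 ^ 2 + X7 ^ 3 + X7 ^ 4 + 2 * X7 := by rw [u7]; ring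
  rw [hring, two_eq_zero_R27, zero_mul, add_zero]
  intro h
  have h0 := congrArg (fun z : R27 => z.coeff 0) h
  simp only [X7, single_pow, one_pow, one_def, coeff_add, coeff_single, coeff_zero, Finsupp.coe_add,
    Pi.add_apply, Finsupp.single_apply, Finsupp.coe_zero, Pi.zero_apply] at h0
  revert h0
  decide

/-- `y = 1 + x + x² + x⁴ ≠ 0`. [folklore] -/
private theorem y7_ne_zero : y7 ≠ 0 := by
  have hring : y7 = 1 + X7 + X7 ^ 2 + X7 ^ 4 + 2 * X7 ^ 3 := by rw [y7]; ring
  rw [hring, two_eq_zero_R27, zero_mul, add_zero]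
  intro h
  have h0 := congrArg (fun z : R27 => z.coeff 0) h
  simp only [X7, single_pow, one_pow, one_def, coeff_add, coeff_single, coeff_zero, Finsupp.coe_add,
    Pi.add_apply, Finsupp.single_apply, Finsupp.coe_zero, Pi.zero_apply] at h0
  revert h0
  decide

/-- **The printed sentence "the product of any two non-zero elements in a maximum ideal is non-zero" is
FALSE, even in a semisimple group algebra:** in `𝔽₂[ℤ₇]` the augmentation ideal `J = ker(x ↦ 1)` is
maximal (quotient `𝔽₂`) and contains `u = (1+x)(1+x+x³) ≠ 0`, `y = (1+x)(1+x²+x³) ≠ 0` with `uy =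
(1+x)²(1+x+⋯+x⁶) = (1+x)(x⁷−1) = 0` (qec finding E-8; the intended hypothesis is a MINIMAL ideal,
`mul_ne_zero_of_mem_isAtom`). [cite: LinPryadko2024, §IV.F sentence before Statement 13 "The proof of the following upper bound is based on the fact that the product of any two non-zero elements in a maximum ideal is non-zero" (arXiv:2306.16400 chunk p0011 L133–135); used at §VIII.F (chunk p0020 L87–88)] -/
theorem maximal_counterexample :
    ∃ J : Ideal (AddMonoidAlgebra (ZMod 2) (ZMod 7)), J.IsMaximal ∧
      ∃ u y : AddMonoidAlgebra (ZMod 2) (ZMod 7), u ∈ J ∧ y ∈ J ∧ u ≠ 0 ∧ y ≠ 0 ∧ u * y = 0 := by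
  refine ⟨RingHom.ker aug, RingHom.ker_isMaximal_of_surjective aug aug_surjective, u7, y7, ?_, ?_,
    u7_ne_zero, y7_ne_zero, u7_mul_y7⟩
  · rw [RingHom.mem_ker, u7, map_mul, map_add, map_one, aug_X7, one_add_one_eq_two,
      show (2 : ZMod 2) = 0 from rfl, zero_mul]
  · rw [RingHom.mem_ker, y7, map_mul, map_add, map_one, aug_X7, one_add_one_eq_two,
      show (2 : ZMod 2) = 0 from rfl, zero_mul]

end Counterexample

/-! ### `𝔽₂[ℤ₂]`: a simple (hence semisimple) ideal that is NOT a direct summand — the module reading of the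
hypothesis of LP24 Statement 10 (appended 2026-08-27, qec-lit-3 g6)

[LinPryadko2024, §IV.E Statement 10] (chunk p0011 L48–53) asks that "the ideals `aR` and `Ra` … be semisimple".
Read as "semisimple `R`-modules" this does NOT give `δ_X = δ_Z = 0`: in `R = 𝔽₂[ℤ₂] = 𝔽₂[z]/(z²)`, `z = 1 + x`,
the ideal `zR = {0, z}` is a SIMPLE module, while `LP[1+x, 1+x]` (the `[[4,2,2]]` code) has `δ_X = δ_Z = 1`
(`TwoBlock.fourTwoTwo_defects`). What the printed route uses — and what suffices, `TwoBlockGASemisimpleDefects.lean`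
§DirectSummand — is that the ideals be direct summands (`aR = eR`, `e² = e`); `zR` is not (`z² = 0`). -/

section F2Z2

open AddMonoidAlgebra

/-- `𝔽₂[ℤ₂]`. (definition, auxiliary) [folklore] -/
private abbrev R22 : Type := AddMonoidAlgebra (ZMod 2) (ZMod 2)

/-- `z = 1 + x ∈ 𝔽₂[ℤ₂]` — the element with coefficient function `(1,1) = TwoBlock.onesZ2`. [folklore] -/
private noncomputable def z2 : R22 := single 0 1 + single 1 1

/-- [folklore] -/
private theorem coeff_z2 : ⇑z2.coeff = TwoBlock.onesZ2 := by
  funext g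
  fin_cases g <;> simp +decide [z2, TwoBlock.onesZ2, Finsupp.single_apply]

/-- Every `r ∈ 𝔽₂[ℤ₂]` is `c₀ + c₁ x`. [folklore] -/
private theorem decomp (r : R22) : r = single 0 (r.coeff 0) + single 1 (r.coeff 1) := by
  apply AddMonoidAlgebra.ext
  ext g
  fin_cases g <;> simp +decide [Finsupp.single_apply] <;> rfl

/-- `r z = (c₀ + c₁) z`: the ideal `zR` is `{0, z}`. [folklore] -/
private theorem mul_z2 (r : R22) :
    r * z2 = single 0 (r.coeff 0 + r.coeff 1) + single 1 (r.coeff 0 + r.coeff 1) := by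
  conv_lhs => rw [decomp r]
  apply AddMonoidAlgebra.ext
  ext g
  have h2 : (1 : ZMod 2) + 1 = 0 := by decide
  fin_cases g <;>
    simp +decide [z2, mul_add, add_mul, single_mul_single, Finsupp.single_apply, h2, add_comm]

/-- [folklore] -/
private theorem mem_span_z2 {y : R22} (hy : y ∈ Ideal.span {z2}) : y = 0 ∨ y = z2 := by
  obtain ⟨r, rfl⟩ := Ideal.mem_span_singleton'.mp hy
  rw [mul_z2]
  have h01 : ∀ t : ZMod 2, t = 0 ∨ t = 1 := by decide
  rcases h01 (r.coeff 0 + r.coeff 1) with ht | ht <;> rw [ht]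
  · left
    rw [AddMonoidAlgebra.single_zero, AddMonoidAlgebra.single_zero, add_zero]
  · right
    rfl

/-- [folklore] -/
private theorem z2_ne_zero : z2 ≠ 0 := by
  intro h
  have := congrArg (fun w : R22 => w.coeff 0) h
  simp [z2] at this

/-- [folklore] -/
private theorem z2_mul_z2 : z2 * z2 = 0 := by
  rw [mul_z2]
  have h2 : (1 : ZMod 2) + 1 = 0 := by decide
  simp [z2, h2]

/-- **The ideal `(1+x)𝔽₂[ℤ₂]` is an atom of the ideal lattice** (`= {0, 1+x}`). [cite: LinPryadko2024, §IV.E Statement 10 hypothesis "the ideals aR and Ra … be semisimple" (arXiv:2306.16400 chunk p0011 L48–53)] -/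
theorem f2z2_span_isAtom :
    IsAtom (Ideal.span {(single 0 1 + single 1 1 : AddMonoidAlgebra (ZMod 2) (ZMod 2))}) := by
  change IsAtom (Ideal.span {z2})
  refine ⟨?_, fun J hJ => ?_⟩
  · intro h
    exact z2_ne_zero (by simpa [Ideal.span_singleton_eq_bot] using h)
  · by_contra hJ0
    obtain ⟨y, hyJ, hy0⟩ := (Submodule.ne_bot_iff J).mp hJ0
    have hyI : y ∈ Ideal.span {z2} := hJ.1 hyJ
    rcases mem_span_z2 hyI with rfl | rfl
    · exact hy0 rfl
    · exact hJ.2 ((Ideal.span_singleton_le_iff_mem _).mpr hyJ)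

/-- **… hence a SIMPLE, in particular SEMISIMPLE, `R`-module.** [cite: LinPryadko2024, §IV.E Statement 10 (arXiv:2306.16400 chunk p0011 L48–53)] -/
theorem f2z2_span_isSemisimpleModule :
    IsSemisimpleModule (AddMonoidAlgebra (ZMod 2) (ZMod 2))
      ↥(Ideal.span {(single 0 1 + single 1 1 : AddMonoidAlgebra (ZMod 2) (ZMod 2))}) := by
  haveI : IsSimpleModule (AddMonoidAlgebra (ZMod 2) (ZMod 2))
      ↥(Ideal.span {(single 0 1 + single 1 1 : AddMonoidAlgebra (ZMod 2) (ZMod 2))}) :=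
    isSimpleModule_iff_isAtom.mpr f2z2_span_isAtom
  infer_instance

/-- **… but NOT a direct summand:** no idempotent generates it (`e ∈ {0, z}`, `z² = 0 ≠ z`).
[cite: LinPryadko2024, §II.A "J_R = e_J · F[G] for a right ideal, with idempotent e_J" (arXiv:2306.16400 chunk p0004 L102–105)] -/
theorem f2z2_span_not_idempotent_generated :
    ¬ ∃ e : AddMonoidAlgebra (ZMod 2) (ZMod 2), IsIdempotentElem e ∧
      Ideal.span {(single 0 1 + single 1 1 : AddMonoidAlgebra (ZMod 2) (ZMod 2))} = Ideal.span {e} := by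
  change ¬ ∃ e, IsIdempotentElem e ∧ Ideal.span {z2} = Ideal.span {e}
  rintro ⟨e, he, hI⟩
  have heI : e ∈ Ideal.span {z2} := hI ▸ Ideal.mem_span_singleton_self e
  rcases mem_span_z2 heI with rfl | rfl
  · have : z2 ∈ (Ideal.span {(0 : R22)}) := hI ▸ Ideal.mem_span_singleton_self z2
    rw [Ideal.span_singleton_eq_bot.mpr rfl, Submodule.mem_bot] at this
    exact z2_ne_zero this
  · exact z2_ne_zero (by rw [← he.eq, z2_mul_z2])

/-- **LP24 Statement 10 under the module reading FAILS:** for `R = 𝔽₂[ℤ₂]` and `a = b = 1 + x` (coefficient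
function `TwoBlock.onesZ2`) the ideal `aR = Ra` is a semisimple `R`-module, yet the two-block code
`LP[1+x, 1+x]` — `A = B = circulant onesZ2`, the `[[4,2,2]]` code — has `δ_X = δ_Z = 1`.
[cite: LinPryadko2024, §IV.E Statement 10 (arXiv:2306.16400 chunk p0011 L48–53) — hypothesis as printed; §III.A defects (chunk p0006 L84–89)] -/
theorem statement10_moduleReading_counterexample :
    IsSemisimpleModule (AddMonoidAlgebra (ZMod 2) (ZMod 2))
        ↥(Ideal.span {(single 0 1 + single 1 1 : AddMonoidAlgebra (ZMod 2) (ZMod 2))}) ∧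
      ⇑(single 0 1 + single 1 1 : AddMonoidAlgebra (ZMod 2) (ZMod 2)).coeff = TwoBlock.onesZ2 ∧
      TwoBlock.defectX (Matrix.circulant TwoBlock.onesZ2) (Matrix.circulant TwoBlock.onesZ2) = 1 ∧
      TwoBlock.defectZ (Matrix.circulant TwoBlock.onesZ2) (Matrix.circulant TwoBlock.onesZ2) = 1 :=
  ⟨f2z2_span_isSemisimpleModule, coeff_z2, TwoBlock.fourTwoTwo_defects.2.2.2.1,
    TwoBlock.fourTwoTwo_defects.2.2.2.2.1⟩

end F2Z2

end GroupAlgebraIdeal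

end Literature.InformationTheory.QuantumCodes
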